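import Mathlib
import Literature.NumberTheory.LFunctions.Zhang2022.RepairBedUaSignModel
import HarnessLib

/-!
# Zhang (2022), rescue bed (D-0124 (3)) node D130-4 «U-a sign», MODEL side V: the SHAPE DICTIONARY of the bed's
# sign words — `b_m = Re 𝔅_θ(v)/𝔅(u_T)`, `|c_m| = |c₀|/𝔅(u_T)`, `m_X0 = b_m − |c_m|²` — in closed form, the sentence
# «closes at X = 0 ⇔ m_X0 < 0», and kernel windows at all eight registered cells `(v_J | φ) × θ ∈ {5/4, 3/2, 2, 3}`

Topic `Literature/NumberTheory/LFunctions/Zhang2022` (Landau–Siegel audit tree; verdict-neutral).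
Y. Zhang, *Discrete mean estimates and the Landau–Siegel zero*, arXiv:2211.02515v1 (2022) [Zhang2022LandauSiegel] —
**an unrefereed manuscript under adjudication; nothing here asserts or denies any of its claims, and nothing here is
a claim about Landau–Siegel zeros.**

Companion of `RepairBedUaSignModel` (taper `u_T = (1−x)⁺`, `𝔅(u_T) = 8/π + 52π/3`, `c₀(u_T,v) = tailCoupling`,
`|c₀|² = 36π²(1+π²)h⁴` (`v_J`) / `4π²(1+π²)h⁶` (`φ_θ`), the X = 0 closing criteria `taper_jump_closes_iff` /
`taper_phiT_closes_iff` and the SP2 sign table), `RepairBedUaSignCurrencies` (sizes, `C*`/`C_req` windows),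
`RepairBedUaSignThresholds` / `RepairBedUaSignSlots` (atom windows at the three CLOSING cells, `m_K*`, slot thresholds,
`λ_min`); `Re 𝔅_θ(v_J) = 8h/π + 52πh³/3`, `Re 𝔅_θ(φ_θ) = 8h³/(3π) + 44πh⁵/15` (`h = θ − 1`, `RepairBedLenxClosedForms`).
The bed-7 block (BED §4.R) scores its sign words in SHAPE form — the X = 0 block of the two-piece design `u_T ⊕ s·v`
divided by `a = 𝔅(u_T)`: `b_m = k₀/a` (`k₀ = Re 𝔅_θ(v)`), `c_m = c₀/a`, `m_X0 = b_m − |c_m|²` — against the genuine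
shape numbers `b_d = M_vv/M_uu`, `c_d = M_uv/M_uu`: SP3(a) «|c_d|/|c_m| < ½» and SP4 «Δb = b_d − b_m < 0» at EVERY
registered `(v, θ)` cell, SP6 where `m_X0 < 0`. At the five model-PD cells `θ ∈ {5/4, 3/2}` (both `v`) and `(φ, 2)`
— 770 of the 990 registered `u_T` cells — these denominators were numeric-only (lineage C `model7.py`, the referee's
`ua7words.py`). This file records, as theorems of the continued calculus (no definition, no `Prop` placeholder):

* Part 0 — `π`-cleared closed forms on the tree objects: `b_m(v_J,θ) = h(24 + 52π²h²)/(24 + 52π²)`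
  (`shape_bm_jump_eq`), `|c_m|²(v_J,θ) = 324π⁴(1+π²)h⁴/(24 + 52π²)²` (`shape_cmSq_jump_eq`), `m_X0(v_J,θ)`
  (`shape_mX0_jump_eq`); `b_m(φ,θ) = h³(40 + 44π²h²)/(5(24 + 52π²))`, `|c_m|²(φ,θ) = 36π⁴(1+π²)h⁶/(24 + 52π²)²`,
  `m_X0(φ,θ)` (`shape_*_phiT_eq`); the dictionary sentence **«the design closes at X = 0 ⇔ m_X0 < 0»**
  (`taper_jump_closes_iff_mX0_neg`, `taper_phiT_closes_iff_mX0_neg` = `closes_iff` in shape form); `b_m(v_J,2) = 1`;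
* Part 1 — **per registered cell ONE theorem `shapeWindow_<v>_<θ>` with the three five-significant-digit windows
  `b_m ∈ (·,·) ∧ |c_m| ∈ (·,·) ∧ m_X0 ∈ (·,·)`**: `v_J`: `5/4` (0.026095, 0.026096) (0.068140, 0.068141)
  (0.021452, 0.021453) · `3/2` (0.14175, 0.14176) (0.27256, 0.27257) (0.067462, 0.067463) · `2` b_m = 1,
  (1.0902, 1.0903) (−0.18866, −0.18865) · `3` (7.7319, 7.7320) (4.3610, 4.3611) (−11.2865, −11.2864); `φ`: `5/4`
  (0.00039056, 0.00039057) (0.0056784, 0.0056785) (0.00035831, 0.00035832) · `3/2` (0.0069136, 0.0069137)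
  (0.045427, 0.045428) (0.0048500, 0.0048501) · `2` (0.17656, 0.17657) (0.36341, 0.36342) (0.044489, 0.044490) · `3`
  (5.2925, 5.2926) (2.9073, 2.9074) (−3.1601, −3.1600) — the `m_X0` signs are the SP2 table (`taper_jump_closes_two`
  `/_three`, `taper_phiT_closes_three`, `…_not_closes_…`); bed-7's model table `bed7-model-v0.1.json` 0330be6195e25f08
  printed the same numbers (`0.026096 / 0.068141 / 0.021452`, …, `−11.2865`, `−3.16005`); `k₀ = b_m · 𝔅(u_T)` with
  `𝔅(u_T) ∈ (57.00075175, 57.00075176)` (`mainTermForm_taperProfile_window20`).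

Caveat as in the kit: `M_θ`, `θ > 1`, is formula I's calculus CONTINUED past `P`, not a proved main term; the shape
numbers are MODEL-SCALED dictionary constants. Nothing here evaluates a genuine block, touches a registered word, or
asserts an off-diagonal input. Theorems only; no `instance`, no notation. Numeric pre-validation in exact rational
interval arithmetic on the `π²`/`π⁴`/`π⁶` windows below: bed-7 g4 session `work/p8/gen8.py`.

## References

* Y. Zhang, arXiv:2211.02515v1 (2022), §7 Prop 7.1, (7.2) p.33; §8 (8.11)–(8.12). [cite: Zhang2022LandauSiegel, §§7, 8]
-/

noncomputable section

open Complex Real ComplexConjugate Set intervalIntegral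
open _root_.MeasureTheory

namespace Literature.NumberTheory.LFunctions.Zhang2022.Repair.Bed

open KnifeEdge

/-! ### Part 0 — closed forms of the shape numbers and the dictionary sentence «closes ⇔ m_X0 < 0» -/

section ClosedForms

variable {θ : ℝ}

/-- **`b_m(v_J,θ) = Re 𝔅_θ(v_J)/𝔅(u_T) = h(24 + 52π²h²)/(24 + 52π²)`**, `h = θ − 1`.
[cite: Zhang2022LandauSiegel, §7 Prop 7.1, (7.2) p.33] -/
theorem shape_bm_jump_eq (hθ : 1 ≤ θ) :
    (topDiagForm θ (jumpProfile θ) (jumpProfile' θ)).re / mainTermForm taperProfile taperProfile'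
      = (θ - 1) * (24 + 52 * π ^ 2 * (θ - 1) ^ 2) / (24 + 52 * π ^ 2) := by
  rw [topDiagForm_jumpProfile_re hθ, mainTermForm_taperProfile]
  have hπ : π ≠ 0 := Real.pi_ne_zero
  have hD : 24 + 52 * π ^ 2 ≠ 0 := by positivity
  rw [div_eq_div_iff (by positivity) hD]
  field_simp
  ring

/-- **`|c_m|²(v_J,θ) = |c₀(u_T,v_J)|²/𝔅(u_T)² = 324π⁴(1+π²)h⁴/(24 + 52π²)²**, `h = θ − 1`.
[cite: Zhang2022LandauSiegel, §7 (7.2) p.33; §8 (8.11)–(8.12)] -/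
theorem shape_cmSq_jump_eq (hθ : 1 ≤ θ) :
    (‖tailCoupling θ taperProfile (jumpProfile θ)‖ / mainTermForm taperProfile taperProfile') ^ 2
      = 324 * π ^ 4 * (1 + π ^ 2) * (θ - 1) ^ 4 / (24 + 52 * π ^ 2) ^ 2 := by
  rw [div_pow, norm_sq_tailCoupling_taper_jumpProfile hθ, mainTermForm_taperProfile]
  have hπ : π ≠ 0 := Real.pi_ne_zero
  have hD : (24 + 52 * π ^ 2) ^ 2 ≠ 0 := by positivity
  rw [div_eq_div_iff (by positivity) hD]
  field_simp
  ring

/-- **`m_X0(v_J,θ) = b_m − |c_m|² = (h(24 + 52π²h²)(24 + 52π²) − 324π⁴(1+π²)h⁴)/(24 + 52π²)²**, `h = θ − 1`.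
[cite: Zhang2022LandauSiegel, §7 (7.2) p.33; §8 (8.11)–(8.12)] -/
theorem shape_mX0_jump_eq (hθ : 1 ≤ θ) :
    (topDiagForm θ (jumpProfile θ) (jumpProfile' θ)).re / mainTermForm taperProfile taperProfile'
        - (‖tailCoupling θ taperProfile (jumpProfile θ)‖ / mainTermForm taperProfile taperProfile') ^ 2
      = ((θ - 1) * (24 + 52 * π ^ 2 * (θ - 1) ^ 2) * (24 + 52 * π ^ 2)
          - 324 * π ^ 4 * (1 + π ^ 2) * (θ - 1) ^ 4) / (24 + 52 * π ^ 2) ^ 2 := by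
  rw [shape_bm_jump_eq hθ, shape_cmSq_jump_eq hθ]
  have hD : 24 + 52 * π ^ 2 ≠ 0 := by positivity
  field_simp

/-- **`b_m(φ,θ) = Re 𝔅_θ(φ_θ)/𝔅(u_T) = h³(40 + 44π²h²)/(5(24 + 52π²))`**, `h = θ − 1` (by
`profBlockB_archProfile_eq_phiT` this is the arch's `b_m(v_A,θ)`). [cite: Zhang2022LandauSiegel, §7 Prop 7.1, (7.2) p.33] -/
theorem shape_bm_phiT_eq (hθ : 1 ≤ θ) :
    (topDiagForm θ (phiT θ) (phiT' θ)).re / mainTermForm taperProfile taperProfile'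
      = (θ - 1) ^ 3 * (40 + 44 * π ^ 2 * (θ - 1) ^ 2) / (5 * (24 + 52 * π ^ 2)) := by
  rw [topDiagForm_phiT_re hθ, mainTermForm_taperProfile]
  have hπ : π ≠ 0 := Real.pi_ne_zero
  have hD : 5 * (24 + 52 * π ^ 2) ≠ 0 := by positivity
  rw [div_eq_div_iff (by positivity) hD]
  field_simp
  ring

/-- **`|c_m|²(φ,θ) = |c₀(u_T,φ_θ)|²/𝔅(u_T)² = 36π⁴(1+π²)h⁶/(24 + 52π²)²**, `h = θ − 1`.
[cite: Zhang2022LandauSiegel, §7 (7.2) p.33; §8 (8.11)–(8.12)] -/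
theorem shape_cmSq_phiT_eq (hθ : 1 ≤ θ) :
    (‖tailCoupling θ taperProfile (phiT θ)‖ / mainTermForm taperProfile taperProfile') ^ 2
      = 36 * π ^ 4 * (1 + π ^ 2) * (θ - 1) ^ 6 / (24 + 52 * π ^ 2) ^ 2 := by
  rw [div_pow, norm_sq_tailCoupling_taper_phiT hθ, mainTermForm_taperProfile]
  have hπ : π ≠ 0 := Real.pi_ne_zero
  have hD : (24 + 52 * π ^ 2) ^ 2 ≠ 0 := by positivity
  rw [div_eq_div_iff (by positivity) hD]
  field_simp
  ring

/-- **`m_X0(φ,θ) = b_m − |c_m|² = (h³(40 + 44π²h²)(24 + 52π²) − 180π⁴(1+π²)h⁶)/(5(24 + 52π²)²)**, `h = θ − 1`.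
[cite: Zhang2022LandauSiegel, §7 (7.2) p.33; §8 (8.11)–(8.12)] -/
theorem shape_mX0_phiT_eq (hθ : 1 ≤ θ) :
    (topDiagForm θ (phiT θ) (phiT' θ)).re / mainTermForm taperProfile taperProfile'
        - (‖tailCoupling θ taperProfile (phiT θ)‖ / mainTermForm taperProfile taperProfile') ^ 2
      = ((θ - 1) ^ 3 * (40 + 44 * π ^ 2 * (θ - 1) ^ 2) * (24 + 52 * π ^ 2)
          - 180 * π ^ 4 * (1 + π ^ 2) * (θ - 1) ^ 6) / (5 * (24 + 52 * π ^ 2) ^ 2) := by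
  rw [shape_bm_phiT_eq hθ, shape_cmSq_phiT_eq hθ]
  have hD : 24 + 52 * π ^ 2 ≠ 0 := by positivity
  field_simp
  ring

/-- **Dictionary sentence, jump top: the design `u_T ⊕ s·v_J` CLOSES at X = 0 iff `m_X0(v_J,θ) < 0`** (the bed's
`model_closes` column; `taper_jump_closes_iff` in shape form). [cite: Zhang2022LandauSiegel, §7 (7.2) p.33; §8 (8.11)–(8.12)] -/
theorem taper_jump_closes_iff_mX0_neg (hθ : 1 ≤ θ) :
    (∃ s : ℂ, twoPieceMainTerm θ 0 taperProfile taperProfile' (jumpProfile θ) (jumpProfile' θ) s < 0) ↔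
      (topDiagForm θ (jumpProfile θ) (jumpProfile' θ)).re / mainTermForm taperProfile taperProfile'
        - (‖tailCoupling θ taperProfile (jumpProfile θ)‖ / mainTermForm taperProfile taperProfile') ^ 2 < 0 := by
  rw [taper_jump_closes_iff hθ, shape_mX0_jump_eq hθ, div_neg_iff, sub_neg]
  have hπ : 0 < π := Real.pi_pos
  have hπ' : π ≠ 0 := Real.pi_ne_zero
  have hD : 0 < (24 + 52 * π ^ 2) ^ 2 := by positivity
  have h9 : 0 < 9 * π ^ 2 := by positivity
  have e1 : (θ - 1) * (24 + 52 * π ^ 2 * (θ - 1) ^ 2) * (24 + 52 * π ^ 2)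
      = 9 * π ^ 2 * ((8 * (θ - 1) / π + 52 / 3 * π * (θ - 1) ^ 3) * (8 / π + 52 / 3 * π)) := by
    field_simp
    ring
  have e2 : 324 * π ^ 4 * (1 + π ^ 2) * (θ - 1) ^ 4 = 9 * π ^ 2 * (36 * π ^ 2 * (1 + π ^ 2) * (θ - 1) ^ 4) := by
    ring
  rw [e1, e2, mul_lt_mul_iff_right₀ h9]
  constructor
  · exact fun h => Or.inr ⟨h, hD⟩
  · rintro (⟨_, hneg⟩ | ⟨h, -⟩)
    · exact absurd hneg (not_lt.2 hD.le)
    · exact h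

/-- **Dictionary sentence, arch top: `u_T ⊕ s·φ_θ` CLOSES at X = 0 iff `m_X0(φ,θ) < 0`** (`taper_phiT_closes_iff` in
shape form). [cite: Zhang2022LandauSiegel, §7 (7.2) p.33; §8 (8.11)–(8.12)] -/
theorem taper_phiT_closes_iff_mX0_neg (hθ : 1 ≤ θ) :
    (∃ s : ℂ, twoPieceMainTerm θ 0 taperProfile taperProfile' (phiT θ) (phiT' θ) s < 0) ↔
      (topDiagForm θ (phiT θ) (phiT' θ)).re / mainTermForm taperProfile taperProfile'
        - (‖tailCoupling θ taperProfile (phiT θ)‖ / mainTermForm taperProfile taperProfile') ^ 2 < 0 := by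
  rw [taper_phiT_closes_iff hθ, shape_mX0_phiT_eq hθ, div_neg_iff, sub_neg]
  have hπ : 0 < π := Real.pi_pos
  have hπ' : π ≠ 0 := Real.pi_ne_zero
  have hD : 0 < 5 * (24 + 52 * π ^ 2) ^ 2 := by positivity
  have h45 : 0 < 45 * π ^ 2 := by positivity
  have e1 : (θ - 1) ^ 3 * (40 + 44 * π ^ 2 * (θ - 1) ^ 2) * (24 + 52 * π ^ 2)
      = 45 * π ^ 2 * ((8 * (θ - 1) ^ 3 / (3 * π) + 44 / 15 * π * (θ - 1) ^ 5) * (8 / π + 52 / 3 * π)) := by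
    field_simp
    ring
  have e2 : 180 * π ^ 4 * (1 + π ^ 2) * (θ - 1) ^ 6 = 45 * π ^ 2 * (4 * π ^ 2 * (1 + π ^ 2) * (θ - 1) ^ 6) := by
    ring
  rw [e1, e2, mul_lt_mul_iff_right₀ h45]
  constructor
  · exact fun h => Or.inr ⟨h, hD⟩
  · rintro (⟨_, hneg⟩ | ⟨h, -⟩)
    · exact absurd hneg (not_lt.2 hD.le)
    · exact h

/-- **`b_m(v_J,2) = 1`** exactly (`Re 𝔅_2(v_J) = 𝔅(u_T)`, cf. `topDiagForm_jump_two_re_eq_mainTermForm` of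
`RepairBedUaSignThresholds`). [cite: Zhang2022LandauSiegel, §7 Prop 7.1, (7.2) p.33] -/
theorem bm_jump_two_eq_one :
    (topDiagForm 2 (jumpProfile 2) (jumpProfile' 2)).re / mainTermForm taperProfile taperProfile' = 1 := by
  rw [shape_bm_jump_eq (by norm_num : (1:ℝ) ≤ 2), div_eq_one_iff_eq (by positivity)]
  ring

end ClosedForms

/-! ### Part 1 — the shape numbers at the eight registered cells as kernel windows -/

section Windows

/-- Even powers of `π` from the twenty-digit bounds: windows for `π²`, `π⁴`, `π⁶`. [folklore] -/
private theorem pi_even_bounds :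
    9.869604401089358 < π ^ 2 ∧ π ^ 2 < 9.869604401089359
      ∧ 97.40909103400243 < π ^ 4 ∧ π ^ 4 < 97.40909103400244
      ∧ 961.3891935753044 < π ^ 6 ∧ π ^ 6 < 961.3891935753045 := by
  have h1 := Real.pi_gt_d20
  have h2 := Real.pi_lt_d20
  have h0 : (0:ℝ) ≤ 3.14159265358979323846 := by norm_num
  have hπ : 0 ≤ π := Real.pi_pos.le
  have a2 := pow_lt_pow_left₀ h1 h0 (by norm_num : (2:ℕ) ≠ 0)
  have b2 := pow_lt_pow_left₀ h2 hπ (by norm_num : (2:ℕ) ≠ 0)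
  have a4 := pow_lt_pow_left₀ h1 h0 (by norm_num : (4:ℕ) ≠ 0)
  have b4 := pow_lt_pow_left₀ h2 hπ (by norm_num : (4:ℕ) ≠ 0)
  have a6 := pow_lt_pow_left₀ h1 h0 (by norm_num : (6:ℕ) ≠ 0)
  have b6 := pow_lt_pow_left₀ h2 hπ (by norm_num : (6:ℕ) ≠ 0)
  norm_num at a2 b2 a4 b4 a6 b6
  refine ⟨?_, ?_, ?_, ?_, ?_, ?_⟩ <;> linarith

/-- A quotient window from polynomial inequalities: `lo·D < N < hi·D`, `D > 0` ⇒ `lo < N/D < hi`. [folklore] -/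
private theorem div_window' {N D lo hi : ℝ} (hD : 0 < D) (h1 : lo * D < N) (h2 : N < hi * D) :
    lo < N / D ∧ N / D < hi :=
  ⟨(lt_div_iff₀ hD).2 h1, (div_lt_iff₀ hD).2 h2⟩

/-- A window for a nonnegative real from a window for its square. [folklore] -/
private theorem window_of_sq {x lo hi : ℝ} (hx : 0 ≤ x) (hlo : 0 ≤ lo) (hhi : 0 ≤ hi)
    (h1 : lo ^ 2 < x ^ 2) (h2 : x ^ 2 < hi ^ 2) : lo < x ∧ x < hi :=
  ⟨(pow_lt_pow_iff_left₀ hlo hx (by norm_num : (2:ℕ) ≠ 0)).1 h1,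
    (pow_lt_pow_iff_left₀ hx hhi (by norm_num : (2:ℕ) ≠ 0)).1 h2⟩

/-- **Shape numbers at `(v_J, 5/4)`**: `b_m ∈ (0.026095, 0.026096)` (`= 0.0260955818476…`) · `|c_m| ∈ (0.068140, 0.068141)` (`= 0.0681408310832…`) ·
`m_X0 ∈ (0.021452, 0.021453)` (`= 0.0214524089869…`; m_X0 > 0: model PD). [cite: Zhang2022LandauSiegel, §7 (7.2) p.33; §8 (8.11)–(8.12)] -/
theorem shapeWindow_jump_five_quarters :
    (0.026095 < (topDiagForm (5/4) (jumpProfile (5/4)) (jumpProfile' (5/4))).re / mainTermForm taperProfile taperProfile' ∧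
        (topDiagForm (5/4) (jumpProfile (5/4)) (jumpProfile' (5/4))).re / mainTermForm taperProfile taperProfile' < 0.026096) ∧
      (0.068140 < ‖tailCoupling (5/4) taperProfile (jumpProfile (5/4))‖ / mainTermForm taperProfile taperProfile' ∧
        ‖tailCoupling (5/4) taperProfile (jumpProfile (5/4))‖ / mainTermForm taperProfile taperProfile' < 0.068141) ∧
      (0.021452 < (topDiagForm (5/4) (jumpProfile (5/4)) (jumpProfile' (5/4))).re / mainTermForm taperProfile taperProfile'
          - (‖tailCoupling (5/4) taperProfile (jumpProfile (5/4))‖ / mainTermForm taperProfile taperProfile') ^ 2 ∧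
        (topDiagForm (5/4) (jumpProfile (5/4)) (jumpProfile' (5/4))).re / mainTermForm taperProfile taperProfile'
          - (‖tailCoupling (5/4) taperProfile (jumpProfile (5/4))‖ / mainTermForm taperProfile taperProfile') ^ 2 < 0.021453) := by
  obtain ⟨h2l, h2u, h4l, h4u, h6l, h6u⟩ := pi_even_bounds
  have hx : 0 ≤ ‖tailCoupling (5/4) taperProfile (jumpProfile (5/4))‖ / mainTermForm taperProfile taperProfile' :=
    div_nonneg (norm_nonneg _) mainTermForm_taperProfile_pos.le
  refine ⟨?_, ?_, ?_⟩
  · rw [shape_bm_jump_eq (by norm_num : (1:ℝ) ≤ 5/4)]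
    exact div_window' (by positivity) (by nlinarith [h2l, h2u, h4l, h4u, h6l, h6u])
      (by nlinarith [h2l, h2u, h4l, h4u, h6l, h6u])
  · refine window_of_sq hx (by norm_num) (by norm_num) ?_ ?_ <;> rw [shape_cmSq_jump_eq (by norm_num : (1:ℝ) ≤ 5/4)]
    · rw [lt_div_iff₀ (by positivity)]
      nlinarith [h2l, h2u, h4l, h4u, h6l, h6u]
    · rw [div_lt_iff₀ (by positivity)]
      nlinarith [h2l, h2u, h4l, h4u, h6l, h6u]
  · rw [shape_mX0_jump_eq (by norm_num : (1:ℝ) ≤ 5/4)]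
    exact div_window' (by positivity) (by nlinarith [h2l, h2u, h4l, h4u, h6l, h6u])
      (by nlinarith [h2l, h2u, h4l, h4u, h6l, h6u])

/-- **Shape numbers at `(v_J, 3/2)`**: `b_m ∈ (0.14175, 0.14176)` (`= 0.1417529309562…`) · `|c_m| ∈ (0.27256, 0.27257)` (`= 0.2725633243328…`) ·
`m_X0 ∈ (0.067462, 0.067463)` (`= 0.0674621651849…`; m_X0 > 0: model PD). [cite: Zhang2022LandauSiegel, §7 (7.2) p.33; §8 (8.11)–(8.12)] -/
theorem shapeWindow_jump_three_halves :
    (0.14175 < (topDiagForm (3/2) (jumpProfile (3/2)) (jumpProfile' (3/2))).re / mainTermForm taperProfile taperProfile' ∧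
        (topDiagForm (3/2) (jumpProfile (3/2)) (jumpProfile' (3/2))).re / mainTermForm taperProfile taperProfile' < 0.14176) ∧
      (0.27256 < ‖tailCoupling (3/2) taperProfile (jumpProfile (3/2))‖ / mainTermForm taperProfile taperProfile' ∧
        ‖tailCoupling (3/2) taperProfile (jumpProfile (3/2))‖ / mainTermForm taperProfile taperProfile' < 0.27257) ∧
      (0.067462 < (topDiagForm (3/2) (jumpProfile (3/2)) (jumpProfile' (3/2))).re / mainTermForm taperProfile taperProfile'
          - (‖tailCoupling (3/2) taperProfile (jumpProfile (3/2))‖ / mainTermForm taperProfile taperProfile') ^ 2 ∧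
        (topDiagForm (3/2) (jumpProfile (3/2)) (jumpProfile' (3/2))).re / mainTermForm taperProfile taperProfile'
          - (‖tailCoupling (3/2) taperProfile (jumpProfile (3/2))‖ / mainTermForm taperProfile taperProfile') ^ 2 < 0.067463) := by
  obtain ⟨h2l, h2u, h4l, h4u, h6l, h6u⟩ := pi_even_bounds
  have hx : 0 ≤ ‖tailCoupling (3/2) taperProfile (jumpProfile (3/2))‖ / mainTermForm taperProfile taperProfile' :=
    div_nonneg (norm_nonneg _) mainTermForm_taperProfile_pos.le
  refine ⟨?_, ?_, ?_⟩
  · rw [shape_bm_jump_eq (by norm_num : (1:ℝ) ≤ 3/2)]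
    exact div_window' (by positivity) (by nlinarith [h2l, h2u, h4l, h4u, h6l, h6u])
      (by nlinarith [h2l, h2u, h4l, h4u, h6l, h6u])
  · refine window_of_sq hx (by norm_num) (by norm_num) ?_ ?_ <;> rw [shape_cmSq_jump_eq (by norm_num : (1:ℝ) ≤ 3/2)]
    · rw [lt_div_iff₀ (by positivity)]
      nlinarith [h2l, h2u, h4l, h4u, h6l, h6u]
    · rw [div_lt_iff₀ (by positivity)]
      nlinarith [h2l, h2u, h4l, h4u, h6l, h6u]
  · rw [shape_mX0_jump_eq (by norm_num : (1:ℝ) ≤ 3/2)]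
    exact div_window' (by positivity) (by nlinarith [h2l, h2u, h4l, h4u, h6l, h6u])
      (by nlinarith [h2l, h2u, h4l, h4u, h6l, h6u])

/-- **Shape numbers at `(v_J, 2)`**: `b_m = 1` (`bm_jump_two_eq_one`) · `|c_m| ∈ (1.0902, 1.0903)` (`= 1.09025329733…`) ·
`m_X0 ∈ (-0.18866, -0.18865)` (`= -0.188652252341…`; m_X0 < 0: the model CLOSES). [cite: Zhang2022LandauSiegel, §7 (7.2) p.33; §8 (8.11)–(8.12)] -/
theorem shapeWindow_jump_two :
    (1.0902 < ‖tailCoupling 2 taperProfile (jumpProfile 2)‖ / mainTermForm taperProfile taperProfile' ∧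
        ‖tailCoupling 2 taperProfile (jumpProfile 2)‖ / mainTermForm taperProfile taperProfile' < 1.0903) ∧
      (-0.18866 < (topDiagForm 2 (jumpProfile 2) (jumpProfile' 2)).re / mainTermForm taperProfile taperProfile'
          - (‖tailCoupling 2 taperProfile (jumpProfile 2)‖ / mainTermForm taperProfile taperProfile') ^ 2 ∧
        (topDiagForm 2 (jumpProfile 2) (jumpProfile' 2)).re / mainTermForm taperProfile taperProfile'
          - (‖tailCoupling 2 taperProfile (jumpProfile 2)‖ / mainTermForm taperProfile taperProfile') ^ 2 < -0.18865) := by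
  obtain ⟨h2l, h2u, h4l, h4u, h6l, h6u⟩ := pi_even_bounds
  have hx : 0 ≤ ‖tailCoupling 2 taperProfile (jumpProfile 2)‖ / mainTermForm taperProfile taperProfile' :=
    div_nonneg (norm_nonneg _) mainTermForm_taperProfile_pos.le
  refine ⟨?_, ?_⟩
  · refine window_of_sq hx (by norm_num) (by norm_num) ?_ ?_ <;> rw [shape_cmSq_jump_eq (by norm_num : (1:ℝ) ≤ 2)]
    · rw [lt_div_iff₀ (by positivity)]
      nlinarith [h2l, h2u, h4l, h4u, h6l, h6u]
    · rw [div_lt_iff₀ (by positivity)]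
      nlinarith [h2l, h2u, h4l, h4u, h6l, h6u]
  · rw [shape_mX0_jump_eq (by norm_num : (1:ℝ) ≤ 2)]
    exact div_window' (by positivity) (by nlinarith [h2l, h2u, h4l, h4u, h6l, h6u])
      (by nlinarith [h2l, h2u, h4l, h4u, h6l, h6u])

/-- **Shape numbers at `(v_J, 3)`**: `b_m ∈ (7.7319, 7.7320)` (`= 7.73195310469…`) · `|c_m| ∈ (4.3610, 4.3611)` (`= 4.36101318932…`) ·
`m_X0 ∈ (-11.2865, -11.2864)` (`= -11.286482932…`; m_X0 < 0: the model CLOSES). [cite: Zhang2022LandauSiegel, §7 (7.2) p.33; §8 (8.11)–(8.12)] -/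
theorem shapeWindow_jump_three :
    (7.7319 < (topDiagForm 3 (jumpProfile 3) (jumpProfile' 3)).re / mainTermForm taperProfile taperProfile' ∧
        (topDiagForm 3 (jumpProfile 3) (jumpProfile' 3)).re / mainTermForm taperProfile taperProfile' < 7.7320) ∧
      (4.3610 < ‖tailCoupling 3 taperProfile (jumpProfile 3)‖ / mainTermForm taperProfile taperProfile' ∧
        ‖tailCoupling 3 taperProfile (jumpProfile 3)‖ / mainTermForm taperProfile taperProfile' < 4.3611) ∧
      (-11.2865 < (topDiagForm 3 (jumpProfile 3) (jumpProfile' 3)).re / mainTermForm taperProfile taperProfile'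
          - (‖tailCoupling 3 taperProfile (jumpProfile 3)‖ / mainTermForm taperProfile taperProfile') ^ 2 ∧
        (topDiagForm 3 (jumpProfile 3) (jumpProfile' 3)).re / mainTermForm taperProfile taperProfile'
          - (‖tailCoupling 3 taperProfile (jumpProfile 3)‖ / mainTermForm taperProfile taperProfile') ^ 2 < -11.2864) := by
  obtain ⟨h2l, h2u, h4l, h4u, h6l, h6u⟩ := pi_even_bounds
  have hx : 0 ≤ ‖tailCoupling 3 taperProfile (jumpProfile 3)‖ / mainTermForm taperProfile taperProfile' :=
    div_nonneg (norm_nonneg _) mainTermForm_taperProfile_pos.le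
  refine ⟨?_, ?_, ?_⟩
  · rw [shape_bm_jump_eq (by norm_num : (1:ℝ) ≤ 3)]
    exact div_window' (by positivity) (by nlinarith [h2l, h2u, h4l, h4u, h6l, h6u])
      (by nlinarith [h2l, h2u, h4l, h4u, h6l, h6u])
  · refine window_of_sq hx (by norm_num) (by norm_num) ?_ ?_ <;> rw [shape_cmSq_jump_eq (by norm_num : (1:ℝ) ≤ 3)]
    · rw [lt_div_iff₀ (by positivity)]
      nlinarith [h2l, h2u, h4l, h4u, h6l, h6u]
    · rw [div_lt_iff₀ (by positivity)]
      nlinarith [h2l, h2u, h4l, h4u, h6l, h6u]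
  · rw [shape_mX0_jump_eq (by norm_num : (1:ℝ) ≤ 3)]
    exact div_window' (by positivity) (by nlinarith [h2l, h2u, h4l, h4u, h6l, h6u])
      (by nlinarith [h2l, h2u, h4l, h4u, h6l, h6u])

/-- **Shape numbers at `(φ, 5/4)`**: `b_m ∈ (0.00039056, 0.00039057)` (`= 0.0003905609171…`) · `|c_m| ∈ (0.0056784, 0.0056785)` (`= 0.0056784025902…`) ·
`m_X0 ∈ (0.00035831, 0.00035832)` (`= 0.0003583166611…`; m_X0 > 0: model PD). [cite: Zhang2022LandauSiegel, §7 (7.2) p.33; §8 (8.11)–(8.12)] -/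
theorem shapeWindow_phiT_five_quarters :
    (0.00039056 < (topDiagForm (5/4) (phiT (5/4)) (phiT' (5/4))).re / mainTermForm taperProfile taperProfile' ∧
        (topDiagForm (5/4) (phiT (5/4)) (phiT' (5/4))).re / mainTermForm taperProfile taperProfile' < 0.00039057) ∧
      (0.0056784 < ‖tailCoupling (5/4) taperProfile (phiT (5/4))‖ / mainTermForm taperProfile taperProfile' ∧
        ‖tailCoupling (5/4) taperProfile (phiT (5/4))‖ / mainTermForm taperProfile taperProfile' < 0.0056785) ∧
      (0.00035831 < (topDiagForm (5/4) (phiT (5/4)) (phiT' (5/4))).re / mainTermForm taperProfile taperProfile'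
          - (‖tailCoupling (5/4) taperProfile (phiT (5/4))‖ / mainTermForm taperProfile taperProfile') ^ 2 ∧
        (topDiagForm (5/4) (phiT (5/4)) (phiT' (5/4))).re / mainTermForm taperProfile taperProfile'
          - (‖tailCoupling (5/4) taperProfile (phiT (5/4))‖ / mainTermForm taperProfile taperProfile') ^ 2 < 0.00035832) := by
  obtain ⟨h2l, h2u, h4l, h4u, h6l, h6u⟩ := pi_even_bounds
  have hx : 0 ≤ ‖tailCoupling (5/4) taperProfile (phiT (5/4))‖ / mainTermForm taperProfile taperProfile' :=
    div_nonneg (norm_nonneg _) mainTermForm_taperProfile_pos.le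
  refine ⟨?_, ?_, ?_⟩
  · rw [shape_bm_phiT_eq (by norm_num : (1:ℝ) ≤ 5/4)]
    exact div_window' (by positivity) (by nlinarith [h2l, h2u, h4l, h4u, h6l, h6u])
      (by nlinarith [h2l, h2u, h4l, h4u, h6l, h6u])
  · refine window_of_sq hx (by norm_num) (by norm_num) ?_ ?_ <;> rw [shape_cmSq_phiT_eq (by norm_num : (1:ℝ) ≤ 5/4)]
    · rw [lt_div_iff₀ (by positivity)]
      nlinarith [h2l, h2u, h4l, h4u, h6l, h6u]
    · rw [div_lt_iff₀ (by positivity)]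
      nlinarith [h2l, h2u, h4l, h4u, h6l, h6u]
  · rw [shape_mX0_phiT_eq (by norm_num : (1:ℝ) ≤ 5/4)]
    exact div_window' (by positivity) (by nlinarith [h2l, h2u, h4l, h4u, h6l, h6u])
      (by nlinarith [h2l, h2u, h4l, h4u, h6l, h6u])

/-- **Shape numbers at `(φ, 3/2)`**: `b_m ∈ (0.0069136, 0.0069137)` (`= 0.0069136390286…`) · `|c_m| ∈ (0.045427, 0.045428)` (`= 0.0454272207221…`) ·
`m_X0 ∈ (0.0048500, 0.0048501)` (`= 0.0048500066461…`; m_X0 > 0: model PD). [cite: Zhang2022LandauSiegel, §7 (7.2) p.33; §8 (8.11)–(8.12)] -/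
theorem shapeWindow_phiT_three_halves :
    (0.0069136 < (topDiagForm (3/2) (phiT (3/2)) (phiT' (3/2))).re / mainTermForm taperProfile taperProfile' ∧
        (topDiagForm (3/2) (phiT (3/2)) (phiT' (3/2))).re / mainTermForm taperProfile taperProfile' < 0.0069137) ∧
      (0.045427 < ‖tailCoupling (3/2) taperProfile (phiT (3/2))‖ / mainTermForm taperProfile taperProfile' ∧
        ‖tailCoupling (3/2) taperProfile (phiT (3/2))‖ / mainTermForm taperProfile taperProfile' < 0.045428) ∧
      (0.0048500 < (topDiagForm (3/2) (phiT (3/2)) (phiT' (3/2))).re / mainTermForm taperProfile taperProfile'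
          - (‖tailCoupling (3/2) taperProfile (phiT (3/2))‖ / mainTermForm taperProfile taperProfile') ^ 2 ∧
        (topDiagForm (3/2) (phiT (3/2)) (phiT' (3/2))).re / mainTermForm taperProfile taperProfile'
          - (‖tailCoupling (3/2) taperProfile (phiT (3/2))‖ / mainTermForm taperProfile taperProfile') ^ 2 < 0.0048501) := by
  obtain ⟨h2l, h2u, h4l, h4u, h6l, h6u⟩ := pi_even_bounds
  have hx : 0 ≤ ‖tailCoupling (3/2) taperProfile (phiT (3/2))‖ / mainTermForm taperProfile taperProfile' :=
    div_nonneg (norm_nonneg _) mainTermForm_taperProfile_pos.le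
  refine ⟨?_, ?_, ?_⟩
  · rw [shape_bm_phiT_eq (by norm_num : (1:ℝ) ≤ 3/2)]
    exact div_window' (by positivity) (by nlinarith [h2l, h2u, h4l, h4u, h6l, h6u])
      (by nlinarith [h2l, h2u, h4l, h4u, h6l, h6u])
  · refine window_of_sq hx (by norm_num) (by norm_num) ?_ ?_ <;> rw [shape_cmSq_phiT_eq (by norm_num : (1:ℝ) ≤ 3/2)]
    · rw [lt_div_iff₀ (by positivity)]
      nlinarith [h2l, h2u, h4l, h4u, h6l, h6u]
    · rw [div_lt_iff₀ (by positivity)]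
      nlinarith [h2l, h2u, h4l, h4u, h6l, h6u]
  · rw [shape_mX0_phiT_eq (by norm_num : (1:ℝ) ≤ 3/2)]
    exact div_window' (by positivity) (by nlinarith [h2l, h2u, h4l, h4u, h6l, h6u])
      (by nlinarith [h2l, h2u, h4l, h4u, h6l, h6u])

/-- **Shape numbers at `(φ, 2)`**: `b_m ∈ (0.17656, 0.17657)` (`= 0.1765619663671…`) · `|c_m| ∈ (0.36341, 0.36342)` (`= 0.3634177657770…`) ·
`m_X0 ∈ (0.044489, 0.044490)` (`= 0.0444894938847…`; m_X0 > 0: model PD). [cite: Zhang2022LandauSiegel, §7 (7.2) p.33; §8 (8.11)–(8.12)] -/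
theorem shapeWindow_phiT_two :
    (0.17656 < (topDiagForm 2 (phiT 2) (phiT' 2)).re / mainTermForm taperProfile taperProfile' ∧
        (topDiagForm 2 (phiT 2) (phiT' 2)).re / mainTermForm taperProfile taperProfile' < 0.17657) ∧
      (0.36341 < ‖tailCoupling 2 taperProfile (phiT 2)‖ / mainTermForm taperProfile taperProfile' ∧
        ‖tailCoupling 2 taperProfile (phiT 2)‖ / mainTermForm taperProfile taperProfile' < 0.36342) ∧
      (0.044489 < (topDiagForm 2 (phiT 2) (phiT' 2)).re / mainTermForm taperProfile taperProfile'
          - (‖tailCoupling 2 taperProfile (phiT 2)‖ / mainTermForm taperProfile taperProfile') ^ 2 ∧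
        (topDiagForm 2 (phiT 2) (phiT' 2)).re / mainTermForm taperProfile taperProfile'
          - (‖tailCoupling 2 taperProfile (phiT 2)‖ / mainTermForm taperProfile taperProfile') ^ 2 < 0.044490) := by
  obtain ⟨h2l, h2u, h4l, h4u, h6l, h6u⟩ := pi_even_bounds
  have hx : 0 ≤ ‖tailCoupling 2 taperProfile (phiT 2)‖ / mainTermForm taperProfile taperProfile' :=
    div_nonneg (norm_nonneg _) mainTermForm_taperProfile_pos.le
  refine ⟨?_, ?_, ?_⟩
  · rw [shape_bm_phiT_eq (by norm_num : (1:ℝ) ≤ 2)]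
    exact div_window' (by positivity) (by nlinarith [h2l, h2u, h4l, h4u, h6l, h6u])
      (by nlinarith [h2l, h2u, h4l, h4u, h6l, h6u])
  · refine window_of_sq hx (by norm_num) (by norm_num) ?_ ?_ <;> rw [shape_cmSq_phiT_eq (by norm_num : (1:ℝ) ≤ 2)]
    · rw [lt_div_iff₀ (by positivity)]
      nlinarith [h2l, h2u, h4l, h4u, h6l, h6u]
    · rw [div_lt_iff₀ (by positivity)]
      nlinarith [h2l, h2u, h4l, h4u, h6l, h6u]
  · rw [shape_mX0_phiT_eq (by norm_num : (1:ℝ) ≤ 2)]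
    exact div_window' (by positivity) (by nlinarith [h2l, h2u, h4l, h4u, h6l, h6u])
      (by nlinarith [h2l, h2u, h4l, h4u, h6l, h6u])

/-- **Shape numbers at `(φ, 3)`**: `b_m ∈ (5.2925, 5.2926)` (`= 5.29258706334…`) · `|c_m| ∈ (2.9073, 2.9074)` (`= 2.90734212621…`) ·
`m_X0 ∈ (-3.1601, -3.1600)` (`= -3.1600511755…`; m_X0 < 0: the model CLOSES). [cite: Zhang2022LandauSiegel, §7 (7.2) p.33; §8 (8.11)–(8.12)] -/
theorem shapeWindow_phiT_three :
    (5.2925 < (topDiagForm 3 (phiT 3) (phiT' 3)).re / mainTermForm taperProfile taperProfile' ∧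
        (topDiagForm 3 (phiT 3) (phiT' 3)).re / mainTermForm taperProfile taperProfile' < 5.2926) ∧
      (2.9073 < ‖tailCoupling 3 taperProfile (phiT 3)‖ / mainTermForm taperProfile taperProfile' ∧
        ‖tailCoupling 3 taperProfile (phiT 3)‖ / mainTermForm taperProfile taperProfile' < 2.9074) ∧
      (-3.1601 < (topDiagForm 3 (phiT 3) (phiT' 3)).re / mainTermForm taperProfile taperProfile'
          - (‖tailCoupling 3 taperProfile (phiT 3)‖ / mainTermForm taperProfile taperProfile') ^ 2 ∧
        (topDiagForm 3 (phiT 3) (phiT' 3)).re / mainTermForm taperProfile taperProfile'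
          - (‖tailCoupling 3 taperProfile (phiT 3)‖ / mainTermForm taperProfile taperProfile') ^ 2 < -3.1600) := by
  obtain ⟨h2l, h2u, h4l, h4u, h6l, h6u⟩ := pi_even_bounds
  have hx : 0 ≤ ‖tailCoupling 3 taperProfile (phiT 3)‖ / mainTermForm taperProfile taperProfile' :=
    div_nonneg (norm_nonneg _) mainTermForm_taperProfile_pos.le
  refine ⟨?_, ?_, ?_⟩
  · rw [shape_bm_phiT_eq (by norm_num : (1:ℝ) ≤ 3)]
    exact div_window' (by positivity) (by nlinarith [h2l, h2u, h4l, h4u, h6l, h6u])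
      (by nlinarith [h2l, h2u, h4l, h4u, h6l, h6u])
  · refine window_of_sq hx (by norm_num) (by norm_num) ?_ ?_ <;> rw [shape_cmSq_phiT_eq (by norm_num : (1:ℝ) ≤ 3)]
    · rw [lt_div_iff₀ (by positivity)]
      nlinarith [h2l, h2u, h4l, h4u, h6l, h6u]
    · rw [div_lt_iff₀ (by positivity)]
      nlinarith [h2l, h2u, h4l, h4u, h6l, h6u]
  · rw [shape_mX0_phiT_eq (by norm_num : (1:ℝ) ≤ 3)]
    exact div_window' (by positivity) (by nlinarith [h2l, h2u, h4l, h4u, h6l, h6u])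
      (by nlinarith [h2l, h2u, h4l, h4u, h6l, h6u])

end Windows

end Literature.NumberTheory.LFunctions.Zhang2022.Repair.Bed
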